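import Literature.Analysis.FluidPDE.SchefferSingularTimes
import Literature.Analysis.FluidPDE.LerayLocalRegularH1Proofs
import HarnessLib

/-!
# Scheffer's theorem on the singular times of a Leray–Hopf solution: the discharge

Second companion ("proofs") file of `Literature/Analysis/FluidPDE/NSLerayHopf.lean` for the named
fact `Literature.Analysis.FluidPDE.scheffer_singular_times` (**ns.S28**: the singular times of a
Leray–Hopf weak solution of the unforced Navier–Stokes system on `ℝ³ × [0, T₀)` form an
`ℋ^{1/2}`-null set; Leray 1934, §34; Scheffer 1976; Robinson–Rodrigo–Sadowski 2016, Thm. 8.14).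
`SchefferSingularTimes.lean` proves the reduction
`scheffer_singular_times_of_leray_local_regular_H1 : leray_local_regular_H1 →
scheffer_singular_times` (Leray's structure theorem, Leray 1934, §33, from Leray's local regular
`H¹` solutions, and the Vitali covering argument of Leray 1934, §34, (6.5) / Scheffer 1976 /
Robinson–Rodrigo–Sadowski 2016, proof of Thm. 8.14); `LerayLocalRegularH1Proofs.lean` proves the
leaf `leray_local_regular_H1_holds` (from Tao's local `H¹` theory,
`tao2011_H1_local_almost_regular_holds`). This file only composes the two — it is kept separate
so that the reduction file keeps its light import closure.

## Contents

* `scheffer_singular_times_holds` — the discharge of `scheffer_singular_times` (real proof).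

## References

* J. Leray, Sur le mouvement d'un liquide visqueux emplissant l'espace, Acta Math. 63 (1934),
  193–248, §33 (p. 244), §34 (p. 246, (6.5)). [Leray1934]
* V. Scheffer, Turbulence and Hausdorff dimension, in: Turbulence and Navier–Stokes equations
  (Orsay 1975), Lecture Notes in Math. 565, Springer (1976), 174–183. [Scheffer1976]
* J. C. Robinson, J. L. Rodrigo, W. Sadowski, *The Three-Dimensional Navier–Stokes Equations:
  Classical Theory*, CUP (2016), Thm. 8.14. [RobinsonRodrigoSadowskiCUP2016]
-/

namespace Literature.Analysis.FluidPDE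

/-- **Scheffer's theorem on the singular times (discharge of ns.S28).** For every Leray–Hopf weak
solution of the unforced Navier–Stokes system on `ℝ³ × [0, T₀)` the set of singular times in
`(0, T₀)` is `ℋ^{1/2}`-null: `scheffer_singular_times_of_leray_local_regular_H1` (Leray's
structure theorem, Leray 1934, §33, and the covering argument of Leray 1934, §34, (6.5) /
Scheffer 1976 / Robinson–Rodrigo–Sadowski 2016, proof of Thm. 8.14) applied to the tree's
discharge `leray_local_regular_H1_holds` of Leray's local regular `H¹` solutions (Leray 1934,
§§19–24; `LerayLocalRegularH1Proofs.lean`). Real proof.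
[cite: Leray1934, §33 p. 244 and §34 (6.5) p. 246] [cite: Scheffer1976]
[cite: RobinsonRodrigoSadowskiCUP2016, Thm. 8.14] -/
theorem scheffer_singular_times_holds : scheffer_singular_times :=
  scheffer_singular_times_of_leray_local_regular_H1 leray_local_regular_H1_holds

end Literature.Analysis.FluidPDE
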